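import Literature.NumberTheory.GaloisRepresentations.LocalGlobalCohomologyDualityProofs
import HarnessLib

/-!
# Annihilators under a perfect `ℤ/n`-valued pairing: `#S^⊥ · #S = #A` and `(S ∩ T)^⊥ = S^⊥ + T^⊥`

Topic `NumberTheory/GaloisRepresentations` (next to the tree's finite-group duality
`LocalGlobalCohomologyDualityProofs.lean`, `TateDualityCounting.lean`); namespace
`Literature.NumberTheory.GaloisRepresentations`. Theorems only: **no named fact and no definition is
introduced** (D-0026) — the (left) annihilator of a subgroup `S` under `b` is written as the term
`⨅ s ∈ S, (b.flip s).ker` (`mem_iInf_ker_flip_iff : x ∈ ⨅ s ∈ S, (b.flip s).ker ↔ ∀ s ∈ S, b x s = 0`).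

Let `A` be a finite abelian group killed by `n ≠ 0` and `b : A × A → ℤ/n` a bi-additive pairing whose
left adjoint `x ↦ b(x, ·)` is injective (a perfect pairing of the finite group `A` with itself, e.g. the
sum of the local Tate pairings on `⊕_{v ∈ S} H¹(K_v, M)`).  Then:

* `natCard_iInf_ker_flip_mul_natCard`: **`#S^⊥ · #S = #A`** for every subgroup `S` (`S^⊥ ↪ Hom(A/S, ℤ/n)`
  by injectivity, `A/S^⊥ ↪ Hom(S, ℤ/n)`, and `#Hom(B, ℤ/n) = #B`, tree `Nat.card_addMonoidHom_zmod`);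
* `iInf_ker_flip_sup : (S ⊔ T)^⊥ = S^⊥ ⊓ T^⊥` (formal) and
  **`iInf_ker_flip_inf : (S ⊓ T)^⊥ = S^⊥ ⊔ T^⊥`** (the inclusion `⊇` is formal; equality by counting with
  `#(H ⊔ K) · #(H ⊓ K) = #H · #K`, `natCard_sup_mul_natCard_inf`);
* the form used in the proof of the Cassels–Tate theorem, **Milne, *ADT*, I Lemma 6.15**: if `G` and `L`
  are their own annihilators (`G^⊥ = G`: the image of the global classes, Poitou–Tate I 4.10(b);
  `L^⊥ = L`: the product of the local Kummer conditions, local Tate duality for `E`), then an element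
  annihilates `G ∩ L` (the image of the Selmer group) iff it is a sum `g + l`, `g ∈ G`, `l ∈ L`
  (`forall_mem_inf_iff_exists_add_of_self_annihilating`).

Milne, *Arithmetic Duality Theorems*, I §0 (dual of a finite group; (0.19)), I Lemma 6.15 and its proof
("the dual of the diagram …"; `a = a₁ + a₂` with `a₁`, `a₂` in the images of `∏ H⁰(K_v, A)` and
`H¹(G_S, A_m)`).  Motivation: provefact `WeierstrassCurve.exists_casselsTate_pairing` (kernel direction,
Milne I Thm. 6.13(a)).

## References

* [MilneADT2006] J. S. Milne, *Arithmetic Duality Theorems*, 2nd ed. (2006), Ch. I §0 (Prop. 0.19), Lemma 6.15.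
-/

noncomputable section

open Function

namespace Literature.NumberTheory.GaloisRepresentations

/-! ## Formal properties of the annihilator term `⨅ s ∈ S, (b.flip s).ker` -/

section Annihilator

variable {A : Type*} [AddCommGroup A] {Q : Type*} [AddCommGroup Q] (b : A →+ A →+ Q)

/-- Membership in the annihilator term `⨅ s ∈ S, (b.flip s).ker`: `x` annihilates `S`. [folklore] -/
theorem mem_iInf_ker_flip_iff (S : AddSubgroup A) (x : A) :
    x ∈ ⨅ s ∈ S, (b.flip s).ker ↔ ∀ s ∈ S, b x s = 0 := by
  simp only [AddSubgroup.mem_iInf, AddMonoidHom.mem_ker, AddMonoidHom.flip_apply]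

/-- `(S ⊔ T)^⊥ = S^⊥ ⊓ T^⊥` (formal). [folklore] -/
theorem iInf_ker_flip_sup (S T : AddSubgroup A) :
    (⨅ s ∈ S ⊔ T, (b.flip s).ker) = (⨅ s ∈ S, (b.flip s).ker) ⊓ ⨅ s ∈ T, (b.flip s).ker := by
  ext x
  rw [AddSubgroup.mem_inf, mem_iInf_ker_flip_iff, mem_iInf_ker_flip_iff, mem_iInf_ker_flip_iff]
  constructor
  · intro h
    exact ⟨fun s hs => h s (AddSubgroup.mem_sup_left hs), fun s hs => h s (AddSubgroup.mem_sup_right hs)⟩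
  · rintro ⟨hS, hT⟩ s hs
    obtain ⟨y, hy, z, hz, rfl⟩ := AddSubgroup.mem_sup.mp hs
    rw [map_add, hS y hy, hT z hz, add_zero]

/-- `S^⊥ ⊔ T^⊥ ≤ (S ⊓ T)^⊥` (formal). [folklore] -/
theorem sup_iInf_ker_flip_le_inf (S T : AddSubgroup A) :
    (⨅ s ∈ S, (b.flip s).ker) ⊔ (⨅ s ∈ T, (b.flip s).ker) ≤ ⨅ s ∈ S ⊓ T, (b.flip s).ker := by
  intro x hx
  obtain ⟨y, hy, z, hz, rfl⟩ := AddSubgroup.mem_sup.mp hx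
  rw [mem_iInf_ker_flip_iff] at hy hz ⊢
  intro s hs
  obtain ⟨hsS, hsT⟩ := AddSubgroup.mem_inf.mp hs
  rw [map_add, AddMonoidHom.add_apply, hy s hsS, hz s hsT, add_zero]

/-- The annihilator of a self-annihilating subgroup is itself (restatement). [folklore] -/
theorem iInf_ker_flip_eq_of_self_annihilating (S : AddSubgroup A)
    (hS : ∀ x, (∀ y ∈ S, b x y = 0) ↔ x ∈ S) : (⨅ s ∈ S, (b.flip s).ker) = S :=
  AddSubgroup.ext fun x => (mem_iInf_ker_flip_iff b S x).trans (hS x)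

end Annihilator

/-! ## `#(H ⊔ K) · #(H ⊓ K) = #H · #K` -/

section SupInf

variable {A : Type*} [AddCommGroup A]

/-- **`#(H ⊔ K) · #(H ⊓ K) = #H · #K`** for subgroups of an abelian group (second isomorphism
theorem: `[H ⊔ K : K] = [H : H ⊓ K]`, Mathlib `AddSubgroup.relIndex_sup_right`; with Mathlib's
conventions `Nat.card = 0` / `index = 0` for infinite groups the identity holds unconditionally). [folklore] -/
theorem natCard_sup_mul_natCard_inf (H K : AddSubgroup A) :
    Nat.card ↥(H ⊔ K) * Nat.card ↥(H ⊓ K) = Nat.card H * Nat.card K := by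
  have h1 := AddSubgroup.card_mul_index (K.addSubgroupOf (H ⊔ K))
  have h2 := AddSubgroup.card_mul_index (K.addSubgroupOf H)
  have hr : (K.addSubgroupOf (H ⊔ K)).index = (K.addSubgroupOf H).index :=
    AddSubgroup.relIndex_sup_right (K := K) (H := H)
  have hc1 : Nat.card (K.addSubgroupOf (H ⊔ K)) = Nat.card K :=
    Nat.card_congr (AddSubgroup.addSubgroupOfEquivOfLe (le_sup_right : K ≤ H ⊔ K)).toEquiv
  have hc2 : Nat.card (K.addSubgroupOf H) = Nat.card ↥(H ⊓ K) := by
    rw [← AddSubgroup.inf_addSubgroupOf_right K H,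
      Nat.card_congr (AddSubgroup.addSubgroupOfEquivOfLe (inf_le_right : K ⊓ H ≤ H)).toEquiv, inf_comm]
  rw [hc1, hr] at h1
  rw [hc2] at h2
  calc Nat.card ↥(H ⊔ K) * Nat.card ↥(H ⊓ K)
      = Nat.card K * (K.addSubgroupOf H).index * Nat.card ↥(H ⊓ K) := by rw [h1]
    _ = Nat.card K * (Nat.card ↥(H ⊓ K) * (K.addSubgroupOf H).index) := by ring
    _ = Nat.card H * Nat.card K := by rw [h2, mul_comm]

end SupInf

/-! ## Counting with a perfect `ℤ/n`-valued pairing -/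

section Perfect

variable {A : Type*} [AddCommGroup A] [Finite A] {n : ℕ} [NeZero n] (b : A →+ A →+ ZMod n)
variable (hA : ∀ x : A, n • x = 0) (hinj : Injective b)
include hA hinj

/-- **`#S^⊥ · #S = #A`** for every subgroup `S`, when `nA = 0` and the left adjoint of
`b : A × A → ℤ/n` is injective: `S^⊥ ↪ Hom(A/S, ℤ/n)` (by injectivity), `A/S^⊥ ↪ Hom(S, ℤ/n)` (the
restriction map has kernel `S^⊥`), and `#Hom(B, ℤ/n) = #B` for `nB = 0` (tree
`Nat.card_addMonoidHom_zmod`). Milne, *ADT*, I §0 (0.19) (exactness of the dual of a finite group).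
[cite: MilneADT2006, Ch. I §0, Prop. 0.19] -/
theorem natCard_iInf_ker_flip_mul_natCard (S : AddSubgroup A) :
    Nat.card (⨅ s ∈ S, (b.flip s).ker : AddSubgroup A) * Nat.card S = Nat.card A := by
  apply le_antisymm
  · -- `S^⊥ ↪ Hom(A ⧸ S, ℤ/n)`
    have hq : ∀ z : A ⧸ S, n • z = 0 := fun z => by
      induction z using QuotientAddGroup.induction_on with
      | H y => rw [← QuotientAddGroup.mk_nsmul, hA, QuotientAddGroup.mk_zero]
    haveI := finite_addMonoidHom_zmod (A ⧸ S) n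
    let φ : (⨅ s ∈ S, (b.flip s).ker : AddSubgroup A) → (A ⧸ S →+ ZMod n) := fun x =>
      QuotientAddGroup.lift S (b x) fun y hy =>
        (AddMonoidHom.mem_ker).mpr (((mem_iInf_ker_flip_iff b S x).mp x.2) y hy)
    have hφ : Injective φ := by
      intro x x' h
      apply Subtype.ext
      apply hinj
      refine AddMonoidHom.ext fun y => ?_
      have h' := DFunLike.congr_fun h (y : A ⧸ S)
      rwa [QuotientAddGroup.lift_mk, QuotientAddGroup.lift_mk] at h'
    calc Nat.card (⨅ s ∈ S, (b.flip s).ker : AddSubgroup A) * Nat.card S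
        ≤ Nat.card (A ⧸ S →+ ZMod n) * Nat.card S :=
          Nat.mul_le_mul_right _ (Nat.card_le_card_of_injective φ hφ)
      _ = Nat.card (A ⧸ S) * Nat.card S := by rw [Nat.card_addMonoidHom_zmod hq]
      _ = Nat.card A := (AddSubgroup.card_eq_card_quotient_mul_card_addSubgroup S).symm
  · -- `A ⧸ S^⊥ ↪ Hom(S, ℤ/n)` by restriction
    haveI := finite_addMonoidHom_zmod S n
    let r : A →+ (S →+ ZMod n) :=
      AddMonoidHom.mk' (fun x => (b x).comp S.subtype) fun x x' => by
        ext s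
        simp only [map_add, AddMonoidHom.coe_comp, comp_apply, AddMonoidHom.add_apply]
    have hr : ∀ (x : A) (s : S), r x s = b x s := fun _ _ => rfl
    have hker : r.ker = ⨅ s ∈ S, (b.flip s).ker := by
      ext x
      rw [AddMonoidHom.mem_ker, mem_iInf_ker_flip_iff]
      constructor
      · intro h s hs
        rw [← hr x ⟨s, hs⟩, h, AddMonoidHom.zero_apply]
      · intro h
        exact AddMonoidHom.ext fun s => (hr x s).trans (h s s.2)
    have hS : ∀ s : S, n • s = 0 := fun s => Subtype.ext (by
      rw [AddSubgroupClass.coe_nsmul, hA]; rfl)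
    calc Nat.card A = Nat.card (A ⧸ r.ker) * Nat.card r.ker :=
          AddSubgroup.card_eq_card_quotient_mul_card_addSubgroup r.ker
      _ ≤ Nat.card (S →+ ZMod n) * Nat.card r.ker :=
          Nat.mul_le_mul_right _ (Nat.card_le_card_of_injective _ (QuotientAddGroup.kerLift_injective r))
      _ = Nat.card S * Nat.card (⨅ s ∈ S, (b.flip s).ker : AddSubgroup A) := by
          rw [Nat.card_addMonoidHom_zmod hS, hker]
      _ = Nat.card (⨅ s ∈ S, (b.flip s).ker : AddSubgroup A) * Nat.card S := mul_comm _ _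

/-- **`(S ⊓ T)^⊥ = S^⊥ ⊔ T^⊥`** for subgroups `S`, `T` of a finite abelian group `A` killed by `n` with a
`ℤ/n`-valued pairing with injective left adjoint.  `⊇` is formal; by `#U^⊥ · #U = #A`
(`natCard_iInf_ker_flip_mul_natCard`) for `U = S, T, S ⊔ T, S ⊓ T`, `(S ⊔ T)^⊥ = S^⊥ ⊓ T^⊥` and
`#(H ⊔ K) · #(H ⊓ K) = #H · #K` both sides have `#A / #(S ⊓ T)` elements.  Milne, *ADT*, I §0; this is
the linear algebra of the proof of I Lemma 6.15. [cite: MilneADT2006, Ch. I, Lemma 6.15] -/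
theorem iInf_ker_flip_inf (S T : AddSubgroup A) :
    (⨅ s ∈ S ⊓ T, (b.flip s).ker) = (⨅ s ∈ S, (b.flip s).ker) ⊔ ⨅ s ∈ T, (b.flip s).ker := by
  -- the counts
  have cS := natCard_iInf_ker_flip_mul_natCard b hA hinj S
  have cT := natCard_iInf_ker_flip_mul_natCard b hA hinj T
  have cST := natCard_iInf_ker_flip_mul_natCard b hA hinj (S ⊔ T)
  have cP := natCard_iInf_ker_flip_mul_natCard b hA hinj (S ⊓ T)
  have g1 := natCard_sup_mul_natCard_inf (⨅ s ∈ S, (b.flip s).ker : AddSubgroup A) (⨅ s ∈ T, (b.flip s).ker)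
  rw [← iInf_ker_flip_sup b S T] at g1
  have g2 := natCard_sup_mul_natCard_inf S T
  -- `#(S^⊥ ⊔ T^⊥) · #(S ⊓ T) = #A`
  have k1 : Nat.card ↥((⨅ s ∈ S, (b.flip s).ker) ⊔ ⨅ s ∈ T, (b.flip s).ker) * Nat.card A =
      Nat.card (⨅ s ∈ S, (b.flip s).ker : AddSubgroup A) *
        Nat.card (⨅ s ∈ T, (b.flip s).ker : AddSubgroup A) * Nat.card ↥(S ⊔ T) := by
    rw [← cST, ← mul_assoc, g1]
  have k2 : Nat.card ↥((⨅ s ∈ S, (b.flip s).ker) ⊔ ⨅ s ∈ T, (b.flip s).ker) * Nat.card A *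
      (Nat.card ↥(S ⊔ T) * Nat.card ↥(S ⊓ T)) = Nat.card A * Nat.card A * Nat.card ↥(S ⊔ T) := by
    rw [g2, k1]
    calc Nat.card (⨅ s ∈ S, (b.flip s).ker : AddSubgroup A) *
          Nat.card (⨅ s ∈ T, (b.flip s).ker : AddSubgroup A) * Nat.card ↥(S ⊔ T) *
            (Nat.card S * Nat.card T)
        = (Nat.card (⨅ s ∈ S, (b.flip s).ker : AddSubgroup A) * Nat.card S) *
            (Nat.card (⨅ s ∈ T, (b.flip s).ker : AddSubgroup A) * Nat.card T) * Nat.card ↥(S ⊔ T) := by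
          ring
      _ = Nat.card A * Nat.card A * Nat.card ↥(S ⊔ T) := by rw [cS, cT]
  have k3 : Nat.card ↥((⨅ s ∈ S, (b.flip s).ker) ⊔ ⨅ s ∈ T, (b.flip s).ker) * Nat.card ↥(S ⊓ T) =
      Nat.card A := by
    have hpos : 0 < Nat.card A * Nat.card ↥(S ⊔ T) := Nat.mul_pos Nat.card_pos Nat.card_pos
    apply Nat.eq_of_mul_eq_mul_left hpos
    calc Nat.card A * Nat.card ↥(S ⊔ T) *
          (Nat.card ↥((⨅ s ∈ S, (b.flip s).ker) ⊔ ⨅ s ∈ T, (b.flip s).ker) * Nat.card ↥(S ⊓ T))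
        = Nat.card ↥((⨅ s ∈ S, (b.flip s).ker) ⊔ ⨅ s ∈ T, (b.flip s).ker) * Nat.card A *
            (Nat.card ↥(S ⊔ T) * Nat.card ↥(S ⊓ T)) := by ring
      _ = Nat.card A * Nat.card A * Nat.card ↥(S ⊔ T) := k2
      _ = Nat.card A * Nat.card ↥(S ⊔ T) * Nat.card A := by ring
  have k4 : Nat.card ↥((⨅ s ∈ S, (b.flip s).ker) ⊔ ⨅ s ∈ T, (b.flip s).ker) =
      Nat.card (⨅ s ∈ S ⊓ T, (b.flip s).ker : AddSubgroup A) :=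
    Nat.eq_of_mul_eq_mul_right (Nat.card_pos (α := ↥(S ⊓ T))) (k3.trans cP.symm)
  exact (AddSubgroup.eq_of_le_of_card_ge (sup_iInf_ker_flip_le_inf b S T) k4.symm.le).symm

/-- **Milne I Lemma 6.15, linear-algebra form.**  Let `G`, `L ≤ A` be their own annihilators
(`(∀ y ∈ G, b x y = 0) ↔ x ∈ G`, and the same for `L`).  Then `x` annihilates `G ∩ L` iff `x = g + l`
with `g ∈ G`, `l ∈ L`.  (In *ADT*: `A = ⊕_{v ∈ S} H¹(K_v, A_m)` with the sum of the local pairings,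
`G =` image of `H¹(G_S, A_m)` (self-annihilating by Poitou–Tate, I 4.10(b)), `L = ∏_v` image of
`A(K_v)` (self-annihilating by local duality, I 3.4), `G ∩ L =` image of the Selmer group.)
[cite: MilneADT2006, Ch. I, Lemma 6.15] -/
theorem forall_mem_inf_iff_exists_add_of_self_annihilating (G L : AddSubgroup A)
    (hG : ∀ x, (∀ y ∈ G, b x y = 0) ↔ x ∈ G) (hL : ∀ x, (∀ y ∈ L, b x y = 0) ↔ x ∈ L) (x : A) :
    (∀ y ∈ G ⊓ L, b x y = 0) ↔ ∃ g ∈ G, ∃ l ∈ L, g + l = x := by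
  rw [← mem_iInf_ker_flip_iff, iInf_ker_flip_inf b hA hinj G L,
    iInf_ker_flip_eq_of_self_annihilating b G hG, iInf_ker_flip_eq_of_self_annihilating b L hL,
    AddSubgroup.mem_sup]

end Perfect

end Literature.NumberTheory.GaloisRepresentations

end
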